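import Summits.HodgeConjecture.HodgeConjecture.Theorems.BiquadraticSecantLiftTranslates
import Summits.HodgeConjecture.HodgeConjecture.Theorems.BiquadraticSecantLiftBaseChangeTrace
import Literature.AlgebraicGeometry.HodgeTheory.WeilClassesCMReductionSplit
import Literature.AlgebraicGeometry.HodgeTheory.WeilClassesRationalPlane
import Literature.AlgebraicGeometry.HodgeTheory.HodgeRiemannDegreeOneProofs
import HarnessLib

/-!
# BiquadraticSecantLift · X2 — Deligne's discriminant of `(⨁_{Fin 2} A, η, h₂)` relative to `L = ℚ(√-d, √m)`
# is the SPLIT class `[(-1)³]`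

Helper file for crux X2 `BiquadraticBaseChangeHyperbolic` (stmt-HodgeConjecture-22133) of
route-HodgeConjecture-BiquadraticSecantLift. From a discriminant witness `(x, ω_A = t_A·L(k), c, Φ, q₀)` of
`(A, φ, k)` relative to `K = ℚ(√-d)` (Deligne's `HasWeilDiscriminantCM A φ (S + d) 1 3 k _`) and an element
`v ∈ F = ℚ(√m)` with `d v² = -q₀`, we build the witness for `B = ⨁_{Fin 2} A`, `η = (φ ⊕ φ)(𝟙 + ψ_m)`,
`h₂ = π₀^*k + m π₁^*k` relative to `L = ℚ[T]/(R_(d,m)(T²))`: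
`x^B_b = π₀^* x_b`, `ω_B = L(h₂)`, `c^B_{ab·} = ½ t_A (c_{ab0}, c_{ab1}, -d(1+m)c_{ab0}, -d(1+3m)c_{ab1})`,
`Φ_B = toL((t_A/4)·Φ)`, `q_B = (t_A/4)⁶ q₀ (1+√m)⁶`, and `[q_B] = [(-1)³] = splitDiscriminantClassCM R 3`.

Nothing here is a case of the Hodge conjecture (HC is NOT proved; X2 is not proved by this file).

## References
[cite: Deligne1982HodgeCycles, §4 p. 30 (`disc`), Lemma 4.6, Cor. 4.2, p. 34 (`A ⊗ E`)] [cite: Milne1999LefschetzClasses, §1]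
-/

-- every declaration of this problem lives in `Summit.HodgeConjecture.HodgeConjecture.…` (summit = sub-problem)
set_option linter.dupNamespace false

noncomputable section

open CategoryTheory CategoryTheory.Limits Polynomial Module
open Literature.AlgebraicTopology.SingularHomology Literature.Geometry.Kaehler
open Literature.AlgebraicGeometry.HodgeTheory
open Literature.AlgebraicGeometry.Motives (AbelianVariety IsSmoothProjective polarizationPairingOne)
open Literature.AlgebraicGeometry.Milne1999 (sumPolarizationClass)
open Literature.AlgebraicGeometry.VanGeemen1994 (pullbackOne)
open Literature.AlgebraicGeometry.Deligne1982

namespace Summit.HodgeConjecture.HodgeConjecture.BiquadraticSecantLift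

variable {A : AbelianVariety ℂ} {φ : A ⟶ A} {d m : ℕ} {k : complexBetti A.X 2}

/-- `h₂ = π₀^* k + m·π₁^* k` is rational when `k` is. -/
theorem isRationalClass_sumPolarizationClass_two (hQk : IsRationalClass k) :
    IsRationalClass (sumPolarizationClass (fun _ : Fin 2 => A) ![k, (m : ℂ) • k]) := by
  rw [sumPolarizationClass_two_eq]
  have h := (isRationalClass_complexBetti_map (biproduct.π (fun _ : Fin 2 => A) 1).hom.hom.hom hQk).smul (m : ℚ)
  rw [Rat.cast_natCast] at h
  exact (isRationalClass_complexBetti_map (biproduct.π (fun _ : Fin 2 => A) 0).hom.hom.hom hQk).add h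

/-- **Deligne's discriminant of `(⨁_{Fin 2} A, η, h₂)` relative to `L` is the split class `[(-1)³]`.**
Hypotheses: `φ ≫ φ = -d` (`d ≥ 1`), `m` not a square, `P_R` and `P_{S+d}` irreducible, `R_(d,m)` irreducible over `ℚ`
(`F` a field); a rational class `k` on `A` with `L(k) ≠ 0` and `L(h₂) ≠ 0`; an `A`-side discriminant witness
`(x, ω_A, c, Φ, q₀)` relative to `K = ℚ(√-d)` with `ω_A = t_A·L(k)` (`t_A ∈ ℚ^×`), `t_K⁶ det Φ = q₀ ∈ ℚ^×`; and
`v ∈ F` with `d v² = -q₀`. -/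
theorem hasWeilDiscriminantCM_twelvefold_split (hd : 0 < d) (hm : ¬ IsSquare m) (hφ : φ ≫ φ = -(d • 𝟙 A))
    (hirrL : Irreducible (cmPolyQ (bqPoly d m))) (hirrK : Irreducible (cmPolyQ (X + C (d : ℤ))))
    [Fact (Irreducible (realPolyQ (bqPoly d m)))] (hA : 0 < A.dim) (hQk : IsRationalClass k)
    (hLB : lefschetzPow (sumPolarizationClass (fun _ : Fin 2 => A) ![k, (m : ℂ) • k]) ((twelvefold A).dim - 1) 2
      (sumPolarizationClass (fun _ : Fin 2 => A) ![k, (m : ℂ) • k]) ≠ 0)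
    {x : Fin (2 * 3) → complexBetti A.X 1} {ωA : complexBetti A.X (2 + 2 * (A.dim - 1))}
    {c : Fin (2 * 3) → Fin (2 * 3) → Fin (2 * 1) → ℚ} {Φ : Matrix (Fin (2 * 3)) (Fin (2 * 3)) (cmField (X + C (d : ℤ)))}
    {q₀ tA : ℚ} (htA : tA ≠ 0) (hq0 : q₀ ≠ 0)
    (hx : ∀ b, IsRationalClass (x b))
    (hli : LinearIndependent ℂ (fun p : Fin (2 * 1) × Fin (2 * 3) => (pullbackOne A φ ^ (p.1 : ℕ)) (x p.2)))
    (hωA : ωA = ((tA : ℚ) : ℂ) • lefschetzPow k (A.dim - 1) 2 k)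
    (hQx : ∀ (a b : Fin (2 * 3)) (j : Fin (2 * 1)),
      polarizationPairingOne A.X k (A.dim - 1) ((pullbackOne A φ ^ (j : ℕ)) (x a)) (x b) = ((c a b j : ℚ) : ℂ) • ωA)
    (htr : ∀ (a b : Fin (2 * 3)) (j : Fin (2 * 1)),
      Algebra.trace ℚ (cmField (X + C (d : ℤ))) (cmRoot (X + C (d : ℤ)) ^ (j : ℕ) * Φ a b) = c a b j)
    (hq : AdjoinRoot.of (cmPolyQ (X + C (d : ℤ))) q₀ = cmRoot (X + C (d : ℤ)) ^ 6 * Φ.det)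
    {v : realField (bqPoly d m)}
    (hv : (d : realField (bqPoly d m)) * v ^ 2 = AdjoinRoot.of (realPolyQ (bqPoly d m)) (-q₀)) :
    HasWeilDiscriminantCM (twelvefold A) (etaTwo A φ m) (bqPoly d m) 2 3
      (sumPolarizationClass (fun _ : Fin 2 => A) ![k, (m : ℂ) • k]) (splitDiscriminantClassCM (bqPoly d m) 3) := by
  classical
  have hirrF : Irreducible (realPolyQ (bqPoly d m)) := Fact.out
  have hm0 : m ≠ 0 := ne_zero_of_not_isSquare hm
  have hm1 : m ≠ 1 := ne_one_of_not_isSquare hm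
  have hc4 : tA / 4 ≠ 0 := div_ne_zero htA four_ne_zero
  -- ### the data
  let xB : Fin (2 * 3) → complexBetti (twelvefold A).X 1 := fun b ↦
    complexBetti.map (biproduct.π (fun _ : Fin 2 => A) 0).hom.hom.hom 1 (x b)
  let vec : Fin (2 * 3) → Fin (2 * 3) → Fin 4 → ℚ := fun a b ↦
    ![tA * c a b 0, tA * c a b 1, -((d : ℚ) * (1 + (m : ℚ))) * (tA * c a b 0), -((d : ℚ) * (1 + 3 * (m : ℚ))) * (tA * c a b 1)]
  let cB : Fin (2 * 3) → Fin (2 * 3) → Fin (2 * 2) → ℚ := fun a b j ↦ vec a b j / 2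
  let ΦB : Matrix (Fin (2 * 3)) (Fin (2 * 3)) (cmField (bqPoly d m)) := fun a b ↦
    toL d m hirrL hd hm (AdjoinRoot.of (cmPolyQ (X + C (d : ℤ))) (tA / 4) * Φ a b)
  have hqB0 := qB_ne_zero d m hirrL hirrF hd hm hq0 hc4
  refine ⟨xB, lefschetzPow (sumPolarizationClass (fun _ : Fin 2 => A) ![k, (m : ℂ) • k]) ((twelvefold A).dim - 1) 2
      (sumPolarizationClass (fun _ : Fin 2 => A) ![k, (m : ℂ) • k]), cB, ΦB, Units.mk0 _ hqB0,
    fun b ↦ isRationalClass_complexBetti_map _ (hx b), ?_, ?_, hLB, ?_, ?_, ?_, ?_⟩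
  · -- independence of the `24` translates
    exact linearIndependent_translates hφ hd.ne' hm0 hm1 hli
  · -- `ω_B = L(h₂)` is rational
    have hh := isRationalClass_sumPolarizationClass_two (A := A) (m := m) hQk
    exact HodgeRiemannDegreeOne.IsRationalClass.lefschetzPow hh _ hh
  · -- the pairings of the translates
    intro a b j
    have h0 : polarizationPairingOne A.X k (A.dim - 1) (x a) (x b) =
        (((tA * c a b 0 : ℚ) : ℚ) : ℂ) • lefschetzPow k (A.dim - 1) 2 k := by
      have h := hQx a b 0
      rw [Fin.val_zero, pow_zero, Module.End.one_apply, hωA, smul_smul] at h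
      rw [h]; push_cast; ring_nf
    have h1 : polarizationPairingOne A.X k (A.dim - 1) (complexBetti.map φ.hom.hom.hom 1 (x a)) (x b) =
        (((tA * c a b 1 : ℚ) : ℚ) : ℂ) • lefschetzPow k (A.dim - 1) 2 k := by
      have h := hQx a b 1
      rw [Fin.val_one, pow_one, hωA, smul_smul] at h
      change polarizationPairingOne A.X k (A.dim - 1) (pullbackOne A φ (x a)) (x b) = _
      rw [h]; push_cast; ring_nf
    rw [pairing_translate hA hφ h0 h1 j]
    congr 1
    change _ = (((vec a b j / 2 : ℚ)) : ℂ)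
    push_cast
    rfl
  · -- the traces `Tr_{L/ℚ}(tʲ Φ_B ab) = c^B_{abj}`
    intro a b j
    have hsm : ∀ z : cmField (X + C (d : ℤ)), AdjoinRoot.of (cmPolyQ (X + C (d : ℤ))) (tA / 4) * z = (tA / 4) • z :=
      fun z ↦ by rw [Algebra.smul_def, AdjoinRoot.algebraMap_eq]
    have htr0 := htr a b 0
    have htr1 := htr a b 1
    rw [Fin.val_zero, pow_zero, one_mul] at htr0
    rw [Fin.val_one, pow_one] at htr1
    change Algebra.trace ℚ (cmField (bqPoly d m)) (cmRoot (bqPoly d m) ^ (j : ℕ) *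
      toL d m hirrL hd hm (AdjoinRoot.of (cmPolyQ (X + C (d : ℤ))) (tA / 4) * Φ a b)) = vec a b j / 2
    fin_cases j
    · simp only [Fin.zero_eta, pow_zero, one_mul, Fin.isValue]
      rw [trace_toL d m hirrL hirrK hd hm, hsm, map_smul, smul_eq_mul, htr0]
      change _ = (tA * c a b 0) / 2
      ring
    · simp only [Fin.mk_one, pow_one, Fin.isValue]
      rw [trace_cmRoot_mul_toL d m hirrL hirrK hd hm, mul_left_comm, hsm, map_smul, smul_eq_mul, htr1]
      change _ = (tA * c a b 1) / 2
      ring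
    · change Algebra.trace ℚ (cmField (bqPoly d m)) (cmRoot (bqPoly d m) ^ 2 * _) =
        (-((d : ℚ) * (1 + (m : ℚ))) * (tA * c a b 0)) / 2
      rw [trace_cmRoot_sq_mul_toL d m hirrL hirrK hd hm, hsm, map_smul, smul_eq_mul, htr0]
      ring
    · change Algebra.trace ℚ (cmField (bqPoly d m)) (cmRoot (bqPoly d m) ^ 3 * _) =
        (-((d : ℚ) * (1 + 3 * (m : ℚ))) * (tA * c a b 1)) / 2
      rw [trace_cmRoot_pow_three_mul_toL d m hirrL hirrK hd hm, mul_left_comm, hsm, map_smul, smul_eq_mul, htr1]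
      ring
  · -- `ι(q_B) = t⁶ det Φ_B`
    have hD : toL d m hirrL hd hm (cmRoot (X + C (d : ℤ)) ^ 6 * Φ.det) = AdjoinRoot.of (cmPolyQ (bqPoly d m)) q₀ := by
      rw [← hq, toL_of]
    have hΦB : ΦB = (toL d m hirrL hd hm).mapMatrix (AdjoinRoot.of (cmPolyQ (X + C (d : ℤ))) (tA / 4) • Φ) := by
      ext a b
      rfl
    rw [algebraMap_realField_eq, Units.val_mk0, realToCM_qB d m hirrL hd hm hD, hΦB, ← RingHom.map_det,
      Matrix.det_smul, Fintype.card_fin]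
  · -- the class is split
    haveI : Fact (Irreducible (cmPolyQ (bqPoly d m))) := ⟨hirrL⟩
    rw [splitDiscriminantClassCM]
    exact mk_qB_eq_mk_neg_one d m hd hm hv hqB0

end Summit.HodgeConjecture.HodgeConjecture.BiquadraticSecantLift
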